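import Mathlib
import HarnessLib
import Summits.HubbardSuperconductivity.HubbardSuperconductivity.Theorems.KLProgrammeKLRegimeEnginePairTransferPlainIncrement
import Summits.HubbardSuperconductivity.HubbardSuperconductivity.Theorems.KLProgrammeKLRegimeEnginePairTransferRungTwoShellBooking

/-!
# Route `KLProgramme` — ENGINE item stmt-HubbardSuperconductivity-20437 `KLRegimeEngineV17F2`, stub (c) value lane, «(c)-OUT» bricks (M1)+(pp):
# the un-resummed slice increment of a member pair array OUT OF THE PAIR CLASS with its particle–particle term IN THE `ppGain` SLOT of `klEngGeo11`
# (cell gate-hubbard-kl, seat hubbard-kl-k3c2-p2 g18; door map HOME/hubbard-kl-k3c2-p2/OUT-OF-CLASS-E2.md §1 (i), §2 first row)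

`klmf_memberArray_increment_le_rungProfile` (…PlainIncrement) × `rung_mass_le_ppGain_klEngGeo11_all` (…RungTwoShellBooking):
**`klmf_memberArray_increment_le_source_add_ppGain`** — for every step `n → n+1` with `n ≤ n_β`, every family member `ψ = s^K_{n+1,j}` (`n+1 ≤ j`; `j = n+1`
is the PLAIN amplitude), every total momentum `Qm` OUT of the pair class at `n+1`, on an admissible frame (`FrameOK`, `U ≤ klTSU R`, `klBetaMin ≤ β ≤ L`,
`8Gβ ≤ L`) and any a priori size `‖A(t)(x,y)‖ ≤ m` with `m² ≤ 2⁸·(Klam U)²`: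
`‖A 1 x y − A 0 x y‖ ≤ ∫₀¹‖S t x y‖dt + (Klam U)²·klEngGeo11.ppGain (n+1) |p_Qm|_𝕋`
(`S = Ȧ + A·diag ḃ·A` the Riccati defect, whose classes `klmd_defect_le_rows` files).  So of `gainBar klEngGeo11 P U (n+1) |p_Qm|_𝕋 ρd ρx` the pp third is booked by
name; the two `phGain` thirds, `thermalBar`, `eremBar`, `legDressBarQ2` are the source integral's (§2/§5 of the door map).
Composition only; nothing about the model's sizes is asserted; nothing asserts (E2″-F), (c), K3 or superconductivity.  0 kit · 0 lit.
-/

noncomputable section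

namespace Summit.HubbardSuperconductivity.HubbardSuperconductivity.Theorems.KLRegimeSplit

set_option linter.dupNamespace false -- summit = problem name (single-conjunct summit), D-0017

open Finset Matrix Set Literature.MathematicalPhysics.QuantumLattice Literature.Probability.LatticeModels GrassmannAlgebra
open Summit.HubbardSuperconductivity.HubbardSuperconductivity.Theorems.KLProgrammeLegKernels
open Summit.HubbardSuperconductivity.HubbardSuperconductivity.Theorems.DispersionFlow
open Summit.HubbardSuperconductivity.HubbardSuperconductivity.Theorems.KLRegimeWick
open Summit.HubbardSuperconductivity.HubbardSuperconductivity.Theorems.EngineV8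

variable (L M : ℕ) [NeZero L] [NeZero M] (β U μ : ℝ) (K : TrigPolyC4v) {R : RenConsts} {N : ℕ}

/-- **OUT-OF-CLASS SLICE INCREMENT WITH THE pp TERM BOOKED** (module docstring). -/
theorem klmf_memberArray_increment_le_source_add_ppGain (hR : R.WF2) (hU : 0 < U) (hUu : U ≤ klTSU R) (hμ : μ ∈ klWindowC)
    (hK : FrameOK R U N μ K) (hβ : klBetaMin ≤ β) (hβL : β ≤ L) {n j : ℕ} (hn : n ≤ nScales β) (hj : n + 1 ≤ j)
    (hGL : 8 * (4 + 8 / 3 * R.Gfr 1 * U ^ 2) * β ≤ L) {Qm : TorusSite 2 L} (hQ : ¬ IsPairClassAt L Qm (n + 1))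
    (hZ : ∀ Λ ∈ Icc (klScale klE0 (n + 1)) (klScale klE0 n), hubbardEffPartitionFnCT L M β U μ 0 K Λ ≠ 0)
    (A A' : ℝ → Matrix (TorusSite 2 L) (TorusSite 2 L) ℂ)
    (hAdef : A = fun t => Matrix.of fun k k' : TorusSite 2 L => if k ∈ klBall L μ 0 ∧ k' ∈ klBall L μ 0 then
      vertexFn L M β (gaussConv ℂ
        (softCovOf L M β μ K (softSymbolCompl L M β μ K (n + 1) j) + hubbardCovAboveCT L M β μ 0 K (klScale klE0 (n + 1)) -
          hubbardCovAboveCT L M β μ 0 K (klScale klE0 n + t * (klScale klE0 (n + 1) - klScale klE0 n)))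
        (hubbardEffectiveActionCT L M β U μ 0 K (klScale klE0 n + t * (klScale klE0 (n + 1) - klScale klE0 n)))) 4
        ![(((omega0 M, k'), 0), 0), ((((omega0 M).rev, Qm - k'), 1), 0), ((((omega0 M).rev, Qm - k), 1), 1), (((omega0 M, k), 0), 1)]
      else 0)
    (hA'def : A' = fun t => Matrix.of fun k k' : TorusSite 2 L => if k ∈ klBall L μ 0 ∧ k' ∈ klBall L μ 0 then
      (klScale klE0 (n + 1) - klScale klE0 n) • -((2 : ℂ)⁻¹ * vertexFn L M β (gaussConv ℂ
        (softCovOf L M β μ K (softSymbolCompl L M β μ K (n + 1) j) + hubbardCovAboveCT L M β μ 0 K (klScale klE0 (n + 1)) -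
          hubbardCovAboveCT L M β μ 0 K (klScale klE0 n + t * (klScale klE0 (n + 1) - klScale klE0 n)))
        (grassmannDerivPairing ℂ
          (Matrix.of fun X Y : HubbardFieldIdx L M => deriv (fun Λ'' : ℝ => hubbardCovAboveCT L M β μ 0 K Λ'' X Y)
            (klScale klE0 n + t * (klScale klE0 (n + 1) - klScale klE0 n)))
          (hubbardEffectiveActionCT L M β U μ 0 K (klScale klE0 n + t * (klScale klE0 (n + 1) - klScale klE0 n)))
          (hubbardEffectiveActionCT L M β U μ 0 K (klScale klE0 n + t * (klScale klE0 (n + 1) - klScale klE0 n))))) 4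
        ![(((omega0 M, k'), 0), 0), ((((omega0 M).rev, Qm - k'), 1), 0), ((((omega0 M).rev, Qm - k), 1), 1), (((omega0 M, k), 0), 1)])
      else 0)
    (b' : ℝ → TorusSite 2 L → ℂ)
    (hb'def : b' = fun t p => (((klScale klE0 (n + 1) - klScale klE0 n) *
        (klBubbleMass L M β μ K
            (fun k => deriv (fun Λ' => hubbardCutoffWeightCT L M β μ K Λ' k) (klScale klE0 n + t * (klScale klE0 (n + 1) - klScale klE0 n)))
            (fun k => softSymbolCompl L M β μ K (n + 1) j k + (hubbardCutoffWeightCT L M β μ K (klScale klE0 (n + 1)) k -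
              hubbardCutoffWeightCT L M β μ K (klScale klE0 n + t * (klScale klE0 (n + 1) - klScale klE0 n)) k)) Qm p +
          klBubbleMass L M β μ K
            (fun k => softSymbolCompl L M β μ K (n + 1) j k + (hubbardCutoffWeightCT L M β μ K (klScale klE0 (n + 1)) k -
              hubbardCutoffWeightCT L M β μ K (klScale klE0 n + t * (klScale klE0 (n + 1) - klScale klE0 n)) k))
            (fun k => deriv (fun Λ' => hubbardCutoffWeightCT L M β μ K Λ' k) (klScale klE0 n + t * (klScale klE0 (n + 1) - klScale klE0 n)))
            Qm p) : ℝ) : ℂ))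
    (S : ℝ → Matrix (TorusSite 2 L) (TorusSite 2 L) ℂ) (hS : ∀ t ∈ Icc (0 : ℝ) 1, S t = A' t + A t * diagonal (b' t) * A t)
    {P : SplitConsts} {m : ℝ} (hm0 : 0 ≤ m) (hm : m ^ 2 ≤ 2 ^ 8 * (P.Klam * U) ^ 2) (hAm : ∀ t ∈ Icc (0 : ℝ) 1, ∀ x y, ‖A t x y‖ ≤ m)
    (x y : TorusSite 2 L) :
    ‖A 1 x y - A 0 x y‖ ≤ (∫ t in (0 : ℝ)..1, ‖S t x y‖) + (P.Klam * U) ^ 2 * klEngGeo11.ppGain (n + 1) (klTorusNorm L Qm) := by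
  have hβ0 : 0 < β := pos_of_klBetaMin_le hβ
  have hψ : ∀ k, 0 ≤ softSymbolCompl L M β μ K (n + 1) j k := fun k => ((isSoftSymbol_compl (L := L) (M := M) β μ K hj).1 k).1
  have h1 := klmf_memberArray_increment_le_rungProfile L M β μ K U hβ0 n hψ Qm hZ A A' hAdef hA'def b' hb'def S hS hm0 hAm x y
  have h2 := rung_mass_le_ppGain_klEngGeo11_all (M := M) β μ K hR hU hUu hμ hK hβ hβL hn hj hGL hQ hm
  linarith

end Summit.HubbardSuperconductivity.HubbardSuperconductivity.Theorems.KLRegimeSplit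

end
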